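import Mathlib
import Summits.AtomisticToContinuum.Crystallization.Theses.PhononSlackCertificates

/-!
# Route `PhononSlackCertificates`, crux `NearFieldConvexity` (stmt-AtomisticToContinuum-13958), line `Sketch`:
the LAYEREDNESS THRESHOLD toolkit (piece P3 of the stub `stub_perturbativeCoercivity`)

The crux counts the particles `i` whose 2-ball is NOT `η`-LAYERED, where `η`-layered is the inline predicate
"there are a linear isometry `A`, a translation `t`, a spacing `a ∈ [47/50, 1]`, a Hägg word `s` and layer heights
`z` with increments in `[39a/50, 17a/20]` such that the 2-ball of `x i` is two-way `η`-matched (after translating by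
`t`) with the layered set `A {u • u(a) + v • v(a) + L_m • w(a) + z_m • e₃}`".  The perturbative half of the energy
estimate is organised around the LAYEREDNESS THRESHOLD

`θ(i) := sInf {e : ℝ | 0 ≤ e ∧ (the 2-ball of x i is e-layered)}`,

written inline everywhere (no definitions).  This file is its toolkit:

* `layered_mono` — layeredness is monotone in the tolerance;
* `layered_of_two_le` — every 2-ball is `η`-layered for `η ≥ 2` (match everything with the single site `0`);
* `threshold_nonneg`, `threshold_le_two` — `0 ≤ θ(i) ≤ 2`;
* `layered_of_threshold_lt` — `θ(i) < η ⇒ η-layered`;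
* `threshold_le_of_layered` — `0 ≤ η`, `η`-layered `⇒ θ(i) ≤ η`;
* `stub_layeredThresholdToolkit` (registered headline) — `¬ η-layered ⇒ η ≤ θ(i)`.

All `[folklore]` (conditionally complete lattice bookkeeping on `ℝ`).
-/

noncomputable section

open scoped BigOperators
open Literature.MathematicalPhysics.StatisticalMechanics Literature.Geometry.DiscreteGeometry

namespace Summit.AtomisticToContinuum.Crystallization.Theorems.PhononSlackNearFieldConvexity

/-- **Monotonicity of layeredness.**  If the 2-ball of `x i` is `η'`-layered and `η' ≤ η` then it is `η`-layered
(same witnesses). [folklore] -/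
theorem layered_mono {N : ℕ} (x : Fin N → EuclideanSpace ℝ (Fin 3)) (i : Fin N) {η η' : ℝ} (hle : η' ≤ η)
    (h : ∃ (A : EuclideanSpace ℝ (Fin 3) →ₗᵢ[ℝ] EuclideanSpace ℝ (Fin 3)) (t : EuclideanSpace ℝ (Fin 3)) (a : ℝ)
      (s : ℤ → ℤ) (z : ℤ → ℝ), 47 / 50 ≤ a ∧ a ≤ 1 ∧ IsHaggSeq s ∧
      (∀ m : ℤ, 39 / 50 * a ≤ z (m + 1) - z m ∧ z (m + 1) - z m ≤ 17 / 20 * a) ∧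
      (fun S : Set (EuclideanSpace ℝ (Fin 3)) => (∀ j : Fin N, dist (x j) (x i) ≤ 2 → ∃ p ∈ S, dist (x j + t) p ≤ η') ∧
        (∀ p ∈ S, dist p (x i + t) ≤ 2 → ∃ j : Fin N, dist (x j + t) p ≤ η'))
        {p | ∃ m i j : ℤ, p = A (((i : ℝ) • triangularVec₁ a) + ((j : ℝ) • triangularVec₂ a) +
          ((haggLabel s m : ℝ) • barlowOffset a) + (z m • layerNormal 1))}) :
    ∃ (A : EuclideanSpace ℝ (Fin 3) →ₗᵢ[ℝ] EuclideanSpace ℝ (Fin 3)) (t : EuclideanSpace ℝ (Fin 3)) (a : ℝ)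
      (s : ℤ → ℤ) (z : ℤ → ℝ), 47 / 50 ≤ a ∧ a ≤ 1 ∧ IsHaggSeq s ∧
      (∀ m : ℤ, 39 / 50 * a ≤ z (m + 1) - z m ∧ z (m + 1) - z m ≤ 17 / 20 * a) ∧
      (fun S : Set (EuclideanSpace ℝ (Fin 3)) => (∀ j : Fin N, dist (x j) (x i) ≤ 2 → ∃ p ∈ S, dist (x j + t) p ≤ η) ∧
        (∀ p ∈ S, dist p (x i + t) ≤ 2 → ∃ j : Fin N, dist (x j + t) p ≤ η))
        {p | ∃ m i j : ℤ, p = A (((i : ℝ) • triangularVec₁ a) + ((j : ℝ) • triangularVec₂ a) +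
          ((haggLabel s m : ℝ) • barlowOffset a) + (z m • layerNormal 1))} := by
  -- adapted from `layered_mono` in the twin crux's skeleton `Cruxes/NashNearField/Lines/birth.lean`
  obtain ⟨A, t, a, s, z, ha₁, ha₂, hs, hz, h₁, h₂⟩ := h
  refine ⟨A, t, a, s, z, ha₁, ha₂, hs, hz, fun j hj => ?_, fun p hp hd => ?_⟩
  · obtain ⟨p, hp, hd⟩ := h₁ j hj
    exact ⟨p, hp, hd.trans hle⟩
  · obtain ⟨j, hj⟩ := h₂ p hp hd
    exact ⟨j, hj.trans hle⟩

/-- **Coarse layeredness.**  Every 2-ball is `η`-layered for `η ≥ 2`: take `A = id`, `t = −x i`, `a = 1`, the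
constant Hägg word `1`, uniform heights `z m = (4/5) m` (increment `4/5 ∈ [39/50, 17/20]`), and match every particle
of the 2-ball, and every template point within `2` of `x i + t = 0`, with the site `0` (indices `m = u = v = 0`),
resp. with the particle `i` itself. [folklore] -/
theorem layered_of_two_le {N : ℕ} (x : Fin N → EuclideanSpace ℝ (Fin 3)) (i : Fin N) {η : ℝ} (hη : 2 ≤ η) :
    ∃ (A : EuclideanSpace ℝ (Fin 3) →ₗᵢ[ℝ] EuclideanSpace ℝ (Fin 3)) (t : EuclideanSpace ℝ (Fin 3)) (a : ℝ)
      (s : ℤ → ℤ) (z : ℤ → ℝ), 47 / 50 ≤ a ∧ a ≤ 1 ∧ IsHaggSeq s ∧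
      (∀ m : ℤ, 39 / 50 * a ≤ z (m + 1) - z m ∧ z (m + 1) - z m ≤ 17 / 20 * a) ∧
      (fun S : Set (EuclideanSpace ℝ (Fin 3)) => (∀ j : Fin N, dist (x j) (x i) ≤ 2 → ∃ p ∈ S, dist (x j + t) p ≤ η) ∧
        (∀ p ∈ S, dist p (x i + t) ≤ 2 → ∃ j : Fin N, dist (x j + t) p ≤ η))
        {p | ∃ m i j : ℤ, p = A (((i : ℝ) • triangularVec₁ a) + ((j : ℝ) • triangularVec₂ a) +
          ((haggLabel s m : ℝ) • barlowOffset a) + (z m • layerNormal 1))} := by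
  refine ⟨LinearIsometry.id, -x i, 1, fun _ => 1, fun m => 4 / 5 * (m : ℝ), by norm_num, le_rfl,
    fun _ => Or.inl rfl, fun m => ?_, fun j hj => ?_, fun p _ hd => ?_⟩
  · push_cast
    constructor <;> linarith
  · -- the particle `j` is matched with the site `0`
    refine ⟨0, ⟨0, 0, 0, ?_⟩, ?_⟩
    · simp
    · rw [dist_zero_right, ← sub_eq_add_neg, ← dist_eq_norm]
      exact hj.trans hη
  · -- the template point `p` is matched with the particle `i`
    refine ⟨i, ?_⟩
    rw [add_neg_cancel] at hd ⊢
    rw [dist_comm]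
    exact hd.trans hη

/-- **The threshold is nonnegative**: `0 ≤ θ(i) = sInf {e | 0 ≤ e ∧ e-layered}` (all members are `≥ 0`; also
covers the junk value `sInf ∅ = 0`). [folklore] -/
theorem threshold_nonneg {N : ℕ} (x : Fin N → EuclideanSpace ℝ (Fin 3)) (i : Fin N) :
    0 ≤ sInf {e : ℝ | 0 ≤ e ∧ (∃ (A : EuclideanSpace ℝ (Fin 3) →ₗᵢ[ℝ] EuclideanSpace ℝ (Fin 3))
      (t : EuclideanSpace ℝ (Fin 3)) (a : ℝ) (s : ℤ → ℤ) (z : ℤ → ℝ), 47 / 50 ≤ a ∧ a ≤ 1 ∧ IsHaggSeq s ∧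
      (∀ m : ℤ, 39 / 50 * a ≤ z (m + 1) - z m ∧ z (m + 1) - z m ≤ 17 / 20 * a) ∧
      (fun S : Set (EuclideanSpace ℝ (Fin 3)) => (∀ j : Fin N, dist (x j) (x i) ≤ 2 → ∃ p ∈ S, dist (x j + t) p ≤ e) ∧
        (∀ p ∈ S, dist p (x i + t) ≤ 2 → ∃ j : Fin N, dist (x j + t) p ≤ e))
        {p | ∃ m i j : ℤ, p = A (((i : ℝ) • triangularVec₁ a) + ((j : ℝ) • triangularVec₂ a) +
          ((haggLabel s m : ℝ) • barlowOffset a) + (z m • layerNormal 1))})} :=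
  Real.sInf_nonneg fun _ he => he.1

/-- **The threshold is at most `2`** (`2` is a member, `layered_of_two_le`; the set is bounded below by `0`).
[folklore] -/
theorem threshold_le_two {N : ℕ} (x : Fin N → EuclideanSpace ℝ (Fin 3)) (i : Fin N) :
    sInf {e : ℝ | 0 ≤ e ∧ (∃ (A : EuclideanSpace ℝ (Fin 3) →ₗᵢ[ℝ] EuclideanSpace ℝ (Fin 3))
      (t : EuclideanSpace ℝ (Fin 3)) (a : ℝ) (s : ℤ → ℤ) (z : ℤ → ℝ), 47 / 50 ≤ a ∧ a ≤ 1 ∧ IsHaggSeq s ∧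
      (∀ m : ℤ, 39 / 50 * a ≤ z (m + 1) - z m ∧ z (m + 1) - z m ≤ 17 / 20 * a) ∧
      (fun S : Set (EuclideanSpace ℝ (Fin 3)) => (∀ j : Fin N, dist (x j) (x i) ≤ 2 → ∃ p ∈ S, dist (x j + t) p ≤ e) ∧
        (∀ p ∈ S, dist p (x i + t) ≤ 2 → ∃ j : Fin N, dist (x j + t) p ≤ e))
        {p | ∃ m i j : ℤ, p = A (((i : ℝ) • triangularVec₁ a) + ((j : ℝ) • triangularVec₂ a) +
          ((haggLabel s m : ℝ) • barlowOffset a) + (z m • layerNormal 1))})} ≤ 2 :=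
  csInf_le ⟨0, fun _ he => he.1⟩ ⟨by norm_num, layered_of_two_le x i le_rfl⟩

/-- **Below-threshold tolerances are layered**: if `θ(i) < η` then the 2-ball of `x i` is `η`-layered (pick a
member `e < η` of the threshold set, `exists_lt_of_csInf_lt`, and use monotonicity). [folklore] -/
theorem layered_of_threshold_lt {N : ℕ} (x : Fin N → EuclideanSpace ℝ (Fin 3)) (i : Fin N) {η : ℝ}
    (hlt : sInf {e : ℝ | 0 ≤ e ∧ (∃ (A : EuclideanSpace ℝ (Fin 3) →ₗᵢ[ℝ] EuclideanSpace ℝ (Fin 3))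
      (t : EuclideanSpace ℝ (Fin 3)) (a : ℝ) (s : ℤ → ℤ) (z : ℤ → ℝ), 47 / 50 ≤ a ∧ a ≤ 1 ∧ IsHaggSeq s ∧
      (∀ m : ℤ, 39 / 50 * a ≤ z (m + 1) - z m ∧ z (m + 1) - z m ≤ 17 / 20 * a) ∧
      (fun S : Set (EuclideanSpace ℝ (Fin 3)) => (∀ j : Fin N, dist (x j) (x i) ≤ 2 → ∃ p ∈ S, dist (x j + t) p ≤ e) ∧
        (∀ p ∈ S, dist p (x i + t) ≤ 2 → ∃ j : Fin N, dist (x j + t) p ≤ e))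
        {p | ∃ m i j : ℤ, p = A (((i : ℝ) • triangularVec₁ a) + ((j : ℝ) • triangularVec₂ a) +
          ((haggLabel s m : ℝ) • barlowOffset a) + (z m • layerNormal 1))})} < η) :
    ∃ (A : EuclideanSpace ℝ (Fin 3) →ₗᵢ[ℝ] EuclideanSpace ℝ (Fin 3)) (t : EuclideanSpace ℝ (Fin 3)) (a : ℝ)
      (s : ℤ → ℤ) (z : ℤ → ℝ), 47 / 50 ≤ a ∧ a ≤ 1 ∧ IsHaggSeq s ∧
      (∀ m : ℤ, 39 / 50 * a ≤ z (m + 1) - z m ∧ z (m + 1) - z m ≤ 17 / 20 * a) ∧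
      (fun S : Set (EuclideanSpace ℝ (Fin 3)) => (∀ j : Fin N, dist (x j) (x i) ≤ 2 → ∃ p ∈ S, dist (x j + t) p ≤ η) ∧
        (∀ p ∈ S, dist p (x i + t) ≤ 2 → ∃ j : Fin N, dist (x j + t) p ≤ η))
        {p | ∃ m i j : ℤ, p = A (((i : ℝ) • triangularVec₁ a) + ((j : ℝ) • triangularVec₂ a) +
          ((haggLabel s m : ℝ) • barlowOffset a) + (z m • layerNormal 1))} := by
  obtain ⟨e, he, hlt'⟩ :=
    exists_lt_of_csInf_lt (by exact ⟨2, by norm_num, layered_of_two_le x i le_rfl⟩) hlt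
  exact layered_mono x i hlt'.le he.2

/-- **Layered tolerances bound the threshold**: if `0 ≤ η` and the 2-ball of `x i` is `η`-layered then
`θ(i) ≤ η` (`csInf_le`). [folklore] -/
theorem threshold_le_of_layered {N : ℕ} (x : Fin N → EuclideanSpace ℝ (Fin 3)) (i : Fin N) {η : ℝ} (hη : 0 ≤ η)
    (h : ∃ (A : EuclideanSpace ℝ (Fin 3) →ₗᵢ[ℝ] EuclideanSpace ℝ (Fin 3)) (t : EuclideanSpace ℝ (Fin 3)) (a : ℝ)
      (s : ℤ → ℤ) (z : ℤ → ℝ), 47 / 50 ≤ a ∧ a ≤ 1 ∧ IsHaggSeq s ∧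
      (∀ m : ℤ, 39 / 50 * a ≤ z (m + 1) - z m ∧ z (m + 1) - z m ≤ 17 / 20 * a) ∧
      (fun S : Set (EuclideanSpace ℝ (Fin 3)) => (∀ j : Fin N, dist (x j) (x i) ≤ 2 → ∃ p ∈ S, dist (x j + t) p ≤ η) ∧
        (∀ p ∈ S, dist p (x i + t) ≤ 2 → ∃ j : Fin N, dist (x j + t) p ≤ η))
        {p | ∃ m i j : ℤ, p = A (((i : ℝ) • triangularVec₁ a) + ((j : ℝ) • triangularVec₂ a) +
          ((haggLabel s m : ℝ) • barlowOffset a) + (z m • layerNormal 1))}) :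
    sInf {e : ℝ | 0 ≤ e ∧ (∃ (A : EuclideanSpace ℝ (Fin 3) →ₗᵢ[ℝ] EuclideanSpace ℝ (Fin 3))
      (t : EuclideanSpace ℝ (Fin 3)) (a : ℝ) (s : ℤ → ℤ) (z : ℤ → ℝ), 47 / 50 ≤ a ∧ a ≤ 1 ∧ IsHaggSeq s ∧
      (∀ m : ℤ, 39 / 50 * a ≤ z (m + 1) - z m ∧ z (m + 1) - z m ≤ 17 / 20 * a) ∧
      (fun S : Set (EuclideanSpace ℝ (Fin 3)) => (∀ j : Fin N, dist (x j) (x i) ≤ 2 → ∃ p ∈ S, dist (x j + t) p ≤ e) ∧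
        (∀ p ∈ S, dist p (x i + t) ≤ 2 → ∃ j : Fin N, dist (x j + t) p ≤ e))
        {p | ∃ m i j : ℤ, p = A (((i : ℝ) • triangularVec₁ a) + ((j : ℝ) • triangularVec₂ a) +
          ((haggLabel s m : ℝ) • barlowOffset a) + (z m • layerNormal 1))})} ≤ η :=
  csInf_le ⟨0, fun _ he => he.1⟩ ⟨hη, h⟩

/-- **Registered headline `stub_layeredThresholdToolkit` (piece P3 of `stub_perturbativeCoercivity`): non-layered
tolerances are below the threshold.**  If the 2-ball of `x i` is NOT `η`-layered then `η ≤ θ(i)` (contrapositive of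
`layered_of_threshold_lt`; no sign hypothesis on `η` is needed). [folklore] -/
theorem stub_layeredThresholdToolkit : ∀ (N : ℕ) (x : Fin N → EuclideanSpace ℝ (Fin 3)) (i : Fin N) (η : ℝ), ¬ (∃ (A : EuclideanSpace ℝ (Fin 3) →ₗᵢ[ℝ] EuclideanSpace ℝ (Fin 3)) (t : EuclideanSpace ℝ (Fin 3)) (a : ℝ) (s : ℤ → ℤ) (z : ℤ → ℝ), 47 / 50 ≤ a ∧ a ≤ 1 ∧ IsHaggSeq s ∧ (∀ m : ℤ, 39 / 50 * a ≤ z (m + 1) - z m ∧ z (m + 1) - z m ≤ 17 / 20 * a) ∧ (fun S : Set (EuclideanSpace ℝ (Fin 3)) => (∀ j : Fin N, dist (x j) (x i) ≤ 2 → ∃ p ∈ S, dist (x j + t) p ≤ η) ∧ (∀ p ∈ S, dist p (x i + t) ≤ 2 → ∃ j : Fin N, dist (x j + t) p ≤ η)) {p | ∃ m i j : ℤ, p = A (((i : ℝ) • triangularVec₁ a) + ((j : ℝ) • triangularVec₂ a) + ((haggLabel s m : ℝ) • barlowOffset a) + (z m • layerNormal 1))}) → η ≤ sInf {e : ℝ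 | 0 ≤ e ∧ (∃ (A : EuclideanSpace ℝ (Fin 3) →ₗᵢ[ℝ] EuclideanSpace ℝ (Fin 3)) (t : EuclideanSpace ℝ (Fin 3)) (a : ℝ) (s : ℤ → ℤ) (z : ℤ → ℝ), 47 / 50 ≤ a ∧ a ≤ 1 ∧ IsHaggSeq s ∧ (∀ m : ℤ, 39 / 50 * a ≤ z (m + 1) - z m ∧ z (m + 1) - z m ≤ 17 / 20 * a) ∧ (fun S : Set (EuclideanSpace ℝ (Fin 3)) => (∀ j : Fin N, dist (x j) (x i) ≤ 2 → ∃ p ∈ S, dist (x j + t) p ≤ e) ∧ (∀ p ∈ S, dist p (x i + t) ≤ 2 → ∃ j : Fin N, dist (x j + t) p ≤ e)) {p | ∃ m i j : ℤ, p = A (((i : ℝ) • triangularVec₁ a) + ((j : ℝ) • triangularVec₂ a) + ((haggLabel s m : ℝ) • barlowOffset a) + (z m • layerNormal 1))})} :=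
  fun _ x i _ hnl => not_lt.1 fun hlt => hnl (layered_of_threshold_lt x i hlt)

/-- **Non-layered tolerances are below the threshold** (curried form of the headline, convenient to apply):
`¬ η-layered ⇒ η ≤ θ(i)`. [folklore] -/
theorem threshold_ge_of_not_layered {N : ℕ} (x : Fin N → EuclideanSpace ℝ (Fin 3)) (i : Fin N) {η : ℝ}
    (hnl : ¬ (∃ (A : EuclideanSpace ℝ (Fin 3) →ₗᵢ[ℝ] EuclideanSpace ℝ (Fin 3)) (t : EuclideanSpace ℝ (Fin 3)) (a : ℝ)
      (s : ℤ → ℤ) (z : ℤ → ℝ), 47 / 50 ≤ a ∧ a ≤ 1 ∧ IsHaggSeq s ∧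
      (∀ m : ℤ, 39 / 50 * a ≤ z (m + 1) - z m ∧ z (m + 1) - z m ≤ 17 / 20 * a) ∧
      (fun S : Set (EuclideanSpace ℝ (Fin 3)) => (∀ j : Fin N, dist (x j) (x i) ≤ 2 → ∃ p ∈ S, dist (x j + t) p ≤ η) ∧
        (∀ p ∈ S, dist p (x i + t) ≤ 2 → ∃ j : Fin N, dist (x j + t) p ≤ η))
        {p | ∃ m i j : ℤ, p = A (((i : ℝ) • triangularVec₁ a) + ((j : ℝ) • triangularVec₂ a) +
          ((haggLabel s m : ℝ) • barlowOffset a) + (z m • layerNormal 1))})) :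
    η ≤ sInf {e : ℝ | 0 ≤ e ∧ (∃ (A : EuclideanSpace ℝ (Fin 3) →ₗᵢ[ℝ] EuclideanSpace ℝ (Fin 3))
      (t : EuclideanSpace ℝ (Fin 3)) (a : ℝ) (s : ℤ → ℤ) (z : ℤ → ℝ), 47 / 50 ≤ a ∧ a ≤ 1 ∧ IsHaggSeq s ∧
      (∀ m : ℤ, 39 / 50 * a ≤ z (m + 1) - z m ∧ z (m + 1) - z m ≤ 17 / 20 * a) ∧
      (fun S : Set (EuclideanSpace ℝ (Fin 3)) => (∀ j : Fin N, dist (x j) (x i) ≤ 2 → ∃ p ∈ S, dist (x j + t) p ≤ e) ∧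
        (∀ p ∈ S, dist p (x i + t) ≤ 2 → ∃ j : Fin N, dist (x j + t) p ≤ e))
        {p | ∃ m i j : ℤ, p = A (((i : ℝ) • triangularVec₁ a) + ((j : ℝ) • triangularVec₂ a) +
          ((haggLabel s m : ℝ) • barlowOffset a) + (z m • layerNormal 1))})} :=
  stub_layeredThresholdToolkit N x i η hnl

end Summit.AtomisticToContinuum.Crystallization.Theorems.PhononSlackNearFieldConvexity
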